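import Summits.RiemannHypothesis.RiemannHypothesis.Theorems.TiltedLandingLaw421R3Lens1ArcSignS

/-!
# W-08 · 33346 · lens-1 part U — THE ρ-THRESHOLD: an a-priori form of the Rouché child certificate

(lens-1 g8; ONE project import = part S `…R3Lens1ArcSignS`; namespace `RhW08.Lens1ArcSign`; 0 `sorry`; checked BY CHAIN over the tree part M with N, P, Q, S inlined.)
Part Sʼs `RoucheCert` asks for ONE inequality on ONE circle: the regular-part variation `‖(φ_reg(z) − φ_reg(a))·(z − a)‖ < (‖c‖/2)·r` around the
linearised child `w₀ = a − 2/c` (`c = f^{(j+2)}(a)/f^{(j+1)}(a) = 2φ_reg(a)`).  Here that inequality is DERIVED from a derivative bound — the complex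
mean-value inequality on the ball `B̄(a, (1+τ)‖2/c‖)` ⊇ `B̄(w₀, τ‖2/c‖)` — so the certificate becomes a statement about ONE number, the isolation ratio
`S·‖2/c‖²` (C6ʼs `ρ = |φ_reg′(a)|/|φ_reg(a)|² = 4|φ_reg′(a)|/‖c‖²`, taken as a sup over the ball):

* §1 `exists_crit_of_derivBound` (abstract): `G` differentiable, `G′/G = (z − a)⁻¹ + ψ` off `a` on the ball, `ψ(a) = c/2`, `ψ` differentiable with `‖ψ′‖ ≤ S`
  on `B̄(a, (1+τ)‖2/c‖)`, `G ≠ 0` there off `a`, `0 < τ < 1` and ★ `S·(1+τ)²·‖2/c‖² < τ` ⇒ a zero of `G′` within `τ‖2/c‖` of `w₀` (part S Rouché + Mathlibʼs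
  `Convex.norm_image_sub_le_of_norm_deriv_le`).  The threshold `τ/(1+τ)²` is maximal `1/4` at `τ = 1`: in C6ʼs normalisation «`ρ_ball < 1/4`».
* §2 the dictionary for `G = f^{(j)}`: with the cofactor `h` of part Q (`f^{(j)} = pairQ·h`, tree `exists_cofactor`), `pairQ_eq_mul_conj`
  (`pairQ (Re a) (Im a) z = (z − a)(z − ā)`), `logDeriv_eq_inv_add_psi` (`f^{(j+1)}/f^{(j)} = (z − a)⁻¹ + ((z − ā)⁻¹ + h′/h)` off the zeros) and
  `psi_apply_top` (`(a − ā)⁻¹ + h′/h(a) = c/2`, from Qʼs `linkStart_cofactor`).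
* §3 `RhoCert f j a τ S` (row-level: `0 < τ < 1`, `(1+τ)‖2/c‖ < Im a`, the landing of `B̄(w₀, τ‖2/c‖)`, ★ `S(1+τ)²‖2/c‖² < τ`, and the COFACTOR DERIVATIVE
  BOUND `‖((z − ā)⁻¹ + h′/h)′‖ ≤ S`, `h ≠ 0` on `B̄(a, (1+τ)‖2/c‖)` — quantified over every factorisation `f^{(j)} = pairQ·h`, so no ∃ is smuggled) and ★★
  `exists_nestedChild_of_rhoCert` ⇒ a non-real child `u` with `NestedStep a u`; row-level `pinning_of_rhoCert`.

BANK READING (`linktoy/rhocert.py` on C6ʼs 1 163-row bank, literal `G = e^{gz}∏(z − p)`, `S` = 1.10 × max of `|ψ′|` on a polar grid of the ball,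
`τ` scanned in `.05 … .95`; 5 cpu-s): ★ `RhoCert` certifies 801/1 163 rows (every one of them also Rouché-certified by part S, which has 946; first
certifying `τ`: .05 ×342, .10 ×194, .15 ×105, .20 ×70, ≥ .25 ×90).  By C6ʼs point ratio `ρ(a) = 4|ψ′(a)|/‖c‖²`: `ρ < .05`: 555/561 · `[.05,.10)`: 213/303 ·
`[.10,.15)`: 33/158 · `ρ ≥ .15`: 0/141 (Rouché: 561 · 283 · 95 · 7) — the a-priori form owns the ISOLATED regime and stops where `ρ_ball` (a sup over the
ball, larger than `ρ(a)`) crosses `τ/(1+τ)² ≤ 1/4`.  The complement (twins / both-sided clusters: lower zeros cancel in `c` but add in `S`) is where the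
near child is not near; there parts T (capture-safe point certificate, 1 163/1 163 on the bank) and the Newton–Rouché certificate do the work.
No law is defined here.  NOT claimed: `RoucheCertLawQ`, `TopLinkLawQ`, `TopPinning`.  Nothing here bears on the truth of RH; RH is not proved.
-/

noncomputable section

namespace RhW08.Lens1ArcSign

open Complex Set Metric Filter Topology
open scoped Real ComplexConjugate
open Literature.Topology.PlaneTopology Literature.Analysis.Complex
open Summit.RiemannHypothesis.RiemannHypothesis.Theorems.Splittings.JensenWindow
open RhIdea6.G17.W07C7 RhIdea6.G17.W07C7.Rev6 RhIdea6.G18.W07C8.Law421BirthS RhIdea6.G19.W07C11.Seam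
open RhIdea6.G20.W07C12.Frac RhIdea6.G20.W07C12.StColP RhW07.C12.FieldSplit RhIdea6.G21.W07C13.TentMax
open RhW07.C14.TwoSided RhW07.C14.Classes RhW07.C14.Lineage RhW07.C14.Booking
open RhW07.C13.Heredity RhIdea6.G22.W07C15pre.Injection RhW07.E3.Cell RhW07.E3.Lit
open RhW08.Round1 RhW08.StSwap RhW08.Round2 RhW08.QuadW RhW08.SealSwapQ RhW08.SealSwap RhW08.SuccB RhW08.SuccSplit
open RhW08.SuccTheft RhW08.Column RhW08.Hurwitz RhW08.ClusterQ RhW08.ClusterQM RhW08.NewtonDoor RhW08.NewtonDoorGenusOne RhW08.PurseP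
open RhW08.Lens1SignCut RhW08.Lens1Coverage RhW08.IsolatedTilt RhW08.Lens1Pinning RhW08.Lens1PinningIso

/-! ## §1 the abstract ρ-threshold -/

/-- ★ ρ-THRESHOLD (abstract): a derivative bound for the regular part `ψ` of `G′/G` at `a` on `B̄(a, (1+τ)‖2/c‖)` with `S(1+τ)²‖2/c‖² < τ` gives part Sʼs
Rouché smallness, hence a critical point of `G` within `τ‖2/c‖` of `w₀ = a − 2/c`. -/
theorem exists_crit_of_derivBound {G ψ : ℂ → ℂ} (hG : Differentiable ℂ G) {a c : ℂ} (hc : c ≠ 0) {τ S : ℝ} (hτ : 0 < τ) (hτ1 : τ < 1)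
    (hψd : ∀ z ∈ closedBall a ((1 + τ) * ‖2 / c‖), DifferentiableAt ℂ ψ z)
    (hψb : ∀ z ∈ closedBall a ((1 + τ) * ‖2 / c‖), ‖deriv ψ z‖ ≤ S)
    (hG0 : ∀ z ∈ closedBall a ((1 + τ) * ‖2 / c‖), z ≠ a → G z ≠ 0)
    (hlog : ∀ z ∈ closedBall a ((1 + τ) * ‖2 / c‖), z ≠ a → deriv G z / G z = (z - a)⁻¹ + ψ z)
    (hψa : ψ a = c / 2) (hρ : S * (1 + τ) ^ 2 * ‖2 / c‖ ^ 2 < τ) :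
    ∃ u : ℂ, ‖u - (a - 2 / c)‖ < τ * ‖2 / c‖ ∧ deriv G u = 0 := by
  have h2c : 0 < ‖2 / c‖ := norm_pos_iff.2 (div_ne_zero two_ne_zero hc)
  have hr : 0 < τ * ‖2 / c‖ := mul_pos hτ h2c
  have hr2 : τ * ‖2 / c‖ < ‖2 / c‖ := by nlinarith
  have haw : a - (a - 2 / c) = 2 / c := by ring
  -- the closed Rouché ball sits inside the big closed ball and misses `a`
  have hsub : ∀ z, ‖z - (a - 2 / c)‖ ≤ τ * ‖2 / c‖ → z ∈ closedBall a ((1 + τ) * ‖2 / c‖) ∧ z ≠ a := by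
    intro z hz
    refine ⟨?_, ?_⟩
    · rw [mem_closedBall, dist_eq_norm]
      calc ‖z - a‖ = ‖(z - (a - 2 / c)) - 2 / c‖ := by ring_nf
        _ ≤ ‖z - (a - 2 / c)‖ + ‖2 / c‖ := norm_sub_le _ _
        _ ≤ (1 + τ) * ‖2 / c‖ := by linarith
    · rintro rfl
      rw [haw] at hz
      linarith
  have ha_mem : a ∈ closedBall a ((1 + τ) * ‖2 / c‖) := mem_closedBall_self (by positivity)
  have hS0 : 0 ≤ S := le_trans (norm_nonneg _) (hψb a ha_mem)
  have hcnorm : ‖c‖ / 2 * (τ * ‖2 / c‖) = τ := by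
    rw [norm_div, Complex.norm_two]
    field_simp
  refine exists_crit_near_linChild hG hc hr hr2 (fun z hz => (hG0 z (hsub z hz).1 (hsub z hz).2)) ?_
  intro z hz
  obtain ⟨hzmem, hza⟩ := hsub z hz.le
  have hmvt : ‖ψ z - ψ a‖ ≤ S * ‖z - a‖ :=
    (convex_closedBall a ((1 + τ) * ‖2 / c‖)).norm_image_sub_le_of_norm_deriv_le hψd hψb ha_mem hzmem
  have hza_le : ‖z - a‖ ≤ (1 + τ) * ‖2 / c‖ := by rw [← dist_eq_norm]; exact hzmem
  rw [hlog z hzmem hza, ← hψa, show ((z - a)⁻¹ + ψ z - (z - a)⁻¹ - ψ a) * (z - a) = (ψ z - ψ a) * (z - a) by ring, norm_mul, hcnorm]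
  calc ‖ψ z - ψ a‖ * ‖z - a‖ ≤ S * ‖z - a‖ * ‖z - a‖ := mul_le_mul_of_nonneg_right hmvt (norm_nonneg _)
    _ ≤ S * ((1 + τ) * ‖2 / c‖) * ((1 + τ) * ‖2 / c‖) := by
        have h1 : S * ‖z - a‖ ≤ S * ((1 + τ) * ‖2 / c‖) := mul_le_mul_of_nonneg_left hza_le hS0
        exact mul_le_mul h1 hza_le (norm_nonneg _) (by positivity)
    _ = S * (1 + τ) ^ 2 * ‖2 / c‖ ^ 2 := by ring
    _ < τ := hρ

/-! ## §2 the dictionary for `G = f^{(j)}`: pair factor, logarithmic derivative, value at the top -/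

/-- `pairQ (Re a) (Im a) z = (z − a)(z − ā)`. -/
theorem pairQ_eq_mul_conj (a z : ℂ) : pairQ a.re a.im z = (z - a) * (z - conj a) := by
  apply Complex.ext
  · rw [RhW08.FarStep.pairQ_re]
    simp only [Complex.mul_re, Complex.sub_re, Complex.sub_im, Complex.conj_re, Complex.conj_im]
    ring
  · rw [RhW08.FarStep.pairQ_im]
    simp only [Complex.mul_im, Complex.sub_re, Complex.sub_im, Complex.conj_re, Complex.conj_im]
    ring

/-- Off the zeros, `(pairQ·h)′/(pairQ·h) = (z − a)⁻¹ + ((z − ā)⁻¹ + h′/h)`. -/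
theorem logDeriv_eq_inv_add_psi {G h : ℂ → ℂ} (hh : Differentiable ℂ h) {a : ℂ} (hfac : ∀ z, G z = pairQ a.re a.im z * h z) {z : ℂ}
    (hza : z ≠ a) (hzb : z ≠ conj a) (hhz : h z ≠ 0) :
    deriv G z / G z = (z - a)⁻¹ + ((z - conj a)⁻¹ + deriv h z / h z) := by
  have eG : G = pairQ a.re a.im * h := funext fun u => by rw [Pi.mul_apply]; exact hfac u
  have hq : HasDerivAt (pairQ a.re a.im) (2 * (z - a.re)) z := RhW07.Law421.SuccessorCertificate.hasDerivAt_quadP a.re a.im z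
  have hd : deriv G z = 2 * (z - a.re) * h z + pairQ a.re a.im z * deriv h z := by rw [eG, (hq.mul (hh z).hasDerivAt).deriv]
  have hza' : z - a ≠ 0 := sub_ne_zero.2 hza
  have hzb' : z - conj a ≠ 0 := sub_ne_zero.2 hzb
  have h2 : (2 : ℂ) * (z - a.re) = (z - a) + (z - conj a) := by
    apply Complex.ext
    · simp; ring
    · simp; ring
  rw [hd, hfac z, pairQ_eq_mul_conj, h2]
  field_simp
  ring

/-- At the top: `(a − ā)⁻¹ + h′/h(a) = c/2` with `c = f^{(j+2)}(a)/f^{(j+1)}(a)` (from Qʼs `linkStart_cofactor` ratio `c = (a − Re a)⁻¹ + 2h′/h(a)`). -/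
theorem psi_apply_top {a K c : ℂ} (ha : a.im ≠ 0) (hratio : c = (a - (a.re : ℂ))⁻¹ + (K + K)) : (a - conj a)⁻¹ + K = c / 2 := by
  have e1 : a - conj a = 2 * (a - (a.re : ℂ)) := by
    apply Complex.ext
    · simp
    · simp; ring
  have hne : a - (a.re : ℂ) ≠ 0 := by
    intro h0
    have := congrArg Complex.im h0
    simp at this
    exact ha this
  rw [hratio, e1, mul_inv]
  field_simp
  ring

/-! ## §3 the ρ-certificate of a top and its producer -/

/-- The ρ-CERTIFICATE of a zero `a` of `f^{(j)}` (row-level, explicit; `c := f^{(j+2)}(a)/f^{(j+1)}(a)`, `w₀ := a − 2/c`, `R₁ := (1+τ)‖2/c‖`): `0 < τ < 1`,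
`R₁ < Im a`, the Rouché ball `B̄(w₀, τ‖2/c‖)` lands in aʼs closed disc above the axis, ★ `S(1+τ)²‖2/c‖² < τ`, and for EVERY differentiable cofactor `h`
with `f^{(j)} = pairQ (Re a) (Im a)·h`: `h ≠ 0` and `‖((z − ā)⁻¹ + h′/h)′(z)‖ ≤ S` on `B̄(a, R₁)`. -/
def RhoCert (f : ℂ → ℂ) (j : ℕ) (a : ℂ) (τ S : ℝ) : Prop :=
  let c := iteratedDeriv (j + 2) f a / iteratedDeriv (j + 1) f a
  0 < τ ∧ τ < 1 ∧ (1 + τ) * ‖2 / c‖ < a.im ∧ ‖(a - 2 / c) - (a.re : ℂ)‖ + τ * ‖2 / c‖ ≤ a.im ∧ τ * ‖2 / c‖ < (a - 2 / c).im ∧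
    S * (1 + τ) ^ 2 * ‖2 / c‖ ^ 2 < τ ∧
    ∀ h : ℂ → ℂ, Differentiable ℂ h → (∀ z, iteratedDeriv j f z = pairQ a.re a.im z * h z) →
      ∀ z ∈ closedBall a ((1 + τ) * ‖2 / c‖), h z ≠ 0 ∧ ‖deriv (fun u => (u - conj a)⁻¹ + deriv h u / h u) z‖ ≤ S

/-- ★★ ρ-CERTIFICATE ⇒ NESTED CHILD: `f` real entire of order `< 2`, `a` a SIMPLE upper zero of `f^{(j)}` with `NoTallerToucher`, and `RhoCert f j a τ S` ⇒ a
non-real zero `u` of `f^{(j+1)}` with `NestedStep a u` (within `τ‖2/c‖` of the linearised child). -/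
theorem exists_nestedChild_of_rhoCert {f : ℂ → ℂ} (hf : RealEntireLt2 f) (j : ℕ) {a : ℂ} (ha : iteratedDeriv j f a = 0) (hapos : 0 < a.im)
    (hN : NoTallerToucher f j a) (hsimp : iteratedDeriv (j + 1) f a ≠ 0) {τ S : ℝ} (hR : RhoCert f j a τ S) :
    ∃ u : ℂ, iteratedDeriv (j + 1) f u = 0 ∧ u.im ≠ 0 ∧ NestedStep a u ∧
      ‖u - (a - 2 / (iteratedDeriv (j + 2) f a / iteratedDeriv (j + 1) f a))‖ < τ * ‖2 / (iteratedDeriv (j + 2) f a / iteratedDeriv (j + 1) f a)‖ := by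
  obtain ⟨hτ, hτ1, hR1, hball, hup, hρ, hcof⟩ := hR
  set c : ℂ := iteratedDeriv (j + 2) f a / iteratedDeriv (j + 1) f a with hcdef
  obtain ⟨h, hhd, -, -, hha, hfac, -, hratio⟩ := linkStart_cofactor hf j ha hapos hN hsimp
  have hc : c ≠ 0 := by rw [hcdef]; exact div_ne_zero (deriv2_ne_zero_of_top hf j ha hapos hN hsimp) hsimp
  have hG : Differentiable ℂ (iteratedDeriv j f) := (RhW08.WindowLoss.realEntireLt2_iteratedDeriv hf j).diff
  have hcof' := hcof h hhd hfac
  -- points of the big closed ball are neither `a`… (only off `a` below) nor `ā`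
  have hnb : ∀ z ∈ closedBall a ((1 + τ) * ‖2 / c‖), z ≠ conj a := by
    intro z hz hzb
    rw [mem_closedBall, dist_eq_norm, hzb] at hz
    have e : ‖conj a - a‖ = 2 * a.im := by
      have e1 : conj a - a = -(2 * (a.im : ℂ) * I) := by
        apply Complex.ext
        · simp
        · simp; ring
      rw [e1, norm_neg, norm_mul, norm_mul, Complex.norm_two, Complex.norm_real, Complex.norm_I, mul_one, Real.norm_eq_abs,
        abs_of_pos hapos]
    rw [e] at hz
    linarith
  set ψ : ℂ → ℂ := fun u => (u - conj a)⁻¹ + deriv h u / h u with hψdef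
  have hψd : ∀ z ∈ closedBall a ((1 + τ) * ‖2 / c‖), DifferentiableAt ℂ ψ z := by
    intro z hz
    have h1 : DifferentiableAt ℂ (fun u : ℂ => (u - conj a)⁻¹) z :=
      (differentiableAt_id.sub_const (conj a)).inv (sub_ne_zero.2 (hnb z hz))
    have h2 : DifferentiableAt ℂ (fun u : ℂ => deriv h u / h u) z :=
      ((differentiable_deriv hhd) z).div (hhd z) (hcof' z hz).1
    exact h1.add h2
  have hψb : ∀ z ∈ closedBall a ((1 + τ) * ‖2 / c‖), ‖deriv ψ z‖ ≤ S := fun z hz => (hcof' z hz).2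
  have hG0 : ∀ z ∈ closedBall a ((1 + τ) * ‖2 / c‖), z ≠ a → iteratedDeriv j f z ≠ 0 := by
    intro z hz hza
    rw [hfac z]
    exact mul_ne_zero (pairQ_ne_zero_of_ne hza (hnb z hz)) (hcof' z hz).1
  have hlog : ∀ z ∈ closedBall a ((1 + τ) * ‖2 / c‖), z ≠ a →
      deriv (iteratedDeriv j f) z / iteratedDeriv j f z = (z - a)⁻¹ + ψ z :=
    fun z hz hza => logDeriv_eq_inv_add_psi hhd hfac hza (hnb z hz) (hcof' z hz).1
  have hψa : ψ a = c / 2 := psi_apply_top hapos.ne' (by rw [hcdef]; exact hratio)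
  obtain ⟨u, hu, hu0⟩ := exists_crit_of_derivBound hG hc hτ hτ1 hψd hψb hG0 hlog hψa hρ
  have hs1 : iteratedDeriv (j + 1) f = deriv (iteratedDeriv j f) := iteratedDeriv_succ
  obtain ⟨hn, hupos⟩ := nestedStep_of_near hu hball hup
  exact ⟨u, by rw [hs1]; exact hu0, hupos.ne', hn, hu⟩

/-- Row-level producer: a ρ-certificate at a zero `a` of `f^{(j)}` on a legal frame gives `TopPinning`ʼs first disjunct for `a` (a multiple `a` is its own child). -/
theorem pinning_of_rhoCert {η : ℝ} {f : ℂ → ℂ} {x₀ s hmax R Hs : ℝ} {B : ℕ} (hE : EngineHyps5 2 η f x₀ s hmax R Hs B) {j : ℕ} {a : ℂ}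
    (ha : iteratedDeriv j f a = 0) (hapos : 0 < a.im) (hN : NoTallerToucher f j a) {τ S : ℝ} (hR : RhoCert f j a τ S) :
    (∃ u : ℂ, iteratedDeriv (j + 1) f u = 0 ∧ u.im ≠ 0 ∧ NestedStep a u) ∨ (∃ x : ℝ, |x - a.re| ≤ a.im ∧ NLEventOf f j x) := by
  by_cases hda : iteratedDeriv (j + 1) f a = 0
  · exact Or.inl ⟨a, hda, hapos.ne', by show (a.re - a.re) ^ 2 + a.im ^ 2 ≤ a.im ^ 2; simp⟩
  obtain ⟨u, hu, hui, hn, -⟩ := exists_nestedChild_of_rhoCert (realEntireLt2_of_hyps hE) j ha hapos hN hda hR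
  exact Or.inl ⟨u, hu, hui, hn⟩

end RhW08.Lens1ArcSign
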